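import Mathlib
import HarnessLib

/-!
# Route `EfficiencyFloor`, crux `MaximiserSetRigidity` (stmt-NavierStokesRegularity-25512), part (b), rotating case:
# the rotation path `θ ↦ exp(θW)` of a skew-adjoint generator `W`

Helper file (`--supports stmt-NavierStokesRegularity-25512`), route-independent (Mathlib only). Fifth brick of the
orbit argument for the driftless rotating collapse Liouville theorem (L⁺_rot) (bricks: `…RotatingDrift`,
`…OrbitBlowup`, `…OrbitL3`, `…OrbitTimeDeriv`). For a skew-adjoint `W` (`⟪Wx, y⟫ = −⟪x, Wy⟫`, the item's
hypothesis) on a real Hilbert space: `W⋆ = −W`; `exp(θW)` is unitary, hence a linear isometric equivalence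
`rotExp` (Mathlib's `Unitary.linearIsometryEquiv`) with inverse `exp(−θW)`; `exp(θW)` commutes with `W`;
`θ ↦ exp(θW)` is smooth with derivative `exp(θW)∘W`, so along a phase `φ` with `φ' = −λ²` the paths
`R = exp(φW)`, `R⁻¹ = exp(−φW)` satisfy the hypotheses `R' = −λ² R∘W`, `(R⁻¹)' = λ² R⁻¹∘W` of
`RotatingOrbit.hasDerivAt_rotatingOrbit`.

HONEST FRAMING: a calculus brick; (L⁺_rot), stmt-25512, `ProductionEfficiencyDecay` and Navier–Stokes regularity
stay OPEN; no summit statement is proved. [folklore]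
-/

noncomputable section

-- the problem directory repeats the summit name (`NavierStokesRegularity/NavierStokesRegularity`)
set_option linter.dupNamespace false

namespace Summit.NavierStokesRegularity.NavierStokesRegularity.Theorems

namespace MaximiserSetRigidity

namespace RotatingOrbit

open Set Function InnerProductSpace
open scoped RealInnerProductSpace ContDiff

variable {E : Type*} [NormedAddCommGroup E] [InnerProductSpace ℝ E] [CompleteSpace E]

/-- A skew-adjoint operator (`⟪Wx, y⟫ = −⟪x, Wy⟫`) has `W⋆ = −W`. [folklore] -/
theorem star_eq_neg_of_skew {W : E →L[ℝ] E} (hW : ∀ x y : E, ⟪W x, y⟫ = -⟪x, W y⟫) : star W = -W := by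
  rw [ContinuousLinearMap.star_eq_adjoint]
  symm
  rw [ContinuousLinearMap.eq_adjoint_iff]
  intro x y
  simp [hW]

/-- `exp(θW)` is unitary for skew-adjoint `W` (Mathlib `NormedSpace.exp_mem_unitary_of_mem_skewAdjoint`). [folklore] -/
theorem exp_smul_mem_unitary {W : E →L[ℝ] E} (hW : ∀ x y : E, ⟪W x, y⟫ = -⟪x, W y⟫) (θ : ℝ) :
    NormedSpace.exp (θ • W) ∈ unitary (E →L[ℝ] E) := by
  letI : NormedAlgebra ℚ (E →L[ℝ] E) := NormedAlgebra.restrictScalars ℚ ℝ (E →L[ℝ] E)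
  refine NormedSpace.exp_mem_unitary_of_mem_skewAdjoint ?_
  rw [skewAdjoint.mem_iff, star_smul, star_eq_neg_of_skew hW, smul_neg, star_trivial]

omit [CompleteSpace E] in
/-- `exp(θW)` commutes with `W`. [folklore] -/
theorem exp_smul_apply_comm (W : E →L[ℝ] E) (θ : ℝ) (v : E) :
    NormedSpace.exp (θ • W) (W v) = W (NormedSpace.exp (θ • W) v) := by
  have h : Commute (NormedSpace.exp (θ • W)) W := ((Commute.refl W).smul_left θ).exp_left
  have := congrArg (fun A : E →L[ℝ] E => A v) h.eq
  exact this

/-- `exp(−θW) ∘ exp(θW) = id` pointwise. [folklore] -/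
theorem exp_neg_smul_apply_exp_smul (W : E →L[ℝ] E) (θ : ℝ) (v : E) :
    NormedSpace.exp ((-θ) • W) (NormedSpace.exp (θ • W) v) = v := by
  have hc : Commute ((-θ) • W) (θ • W) := ((Commute.refl W).smul_left (-θ)).smul_right θ
  letI : NormedAlgebra ℚ (E →L[ℝ] E) := NormedAlgebra.restrictScalars ℚ ℝ (E →L[ℝ] E)
  have h : NormedSpace.exp ((-θ) • W) * NormedSpace.exp (θ • W) = 1 := by
    rw [← NormedSpace.exp_add_of_commute hc, neg_smul, neg_add_cancel, NormedSpace.exp_zero]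
  have := congrArg (fun A : E →L[ℝ] E => A v) h
  exact this

/-- `exp(θW) ∘ exp(−θW) = id` pointwise. [folklore] -/
theorem exp_smul_apply_exp_neg_smul (W : E →L[ℝ] E) (θ : ℝ) (v : E) :
    NormedSpace.exp (θ • W) (NormedSpace.exp ((-θ) • W) v) = v := by
  have h := exp_neg_smul_apply_exp_smul W (-θ) v
  rw [neg_neg] at h
  exact h

/-- The linear isometric equivalence `exp(θW)` (skew `W`): its forward map is `exp(θW)`. [folklore] -/
theorem unitaryExp_apply {W : E →L[ℝ] E} (hW : ∀ x y : E, ⟪W x, y⟫ = -⟪x, W y⟫) (θ : ℝ) (v : E) :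
    Unitary.linearIsometryEquiv ⟨NormedSpace.exp (θ • W), exp_smul_mem_unitary hW θ⟩ v =
      NormedSpace.exp (θ • W) v := rfl

/-- … and its inverse is `exp(−θW)` (`(exp θW)⋆ = exp(θW⋆) = exp(−θW)`). [folklore] -/
theorem unitaryExp_symm_apply {W : E →L[ℝ] E} (hW : ∀ x y : E, ⟪W x, y⟫ = -⟪x, W y⟫) (θ : ℝ) (v : E) :
    (Unitary.linearIsometryEquiv ⟨NormedSpace.exp (θ • W), exp_smul_mem_unitary hW θ⟩).symm v =
      NormedSpace.exp ((-θ) • W) v := by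
  change (star (NormedSpace.exp (θ • W))) v = _
  rw [NormedSpace.star_exp, star_smul, star_eq_neg_of_skew hW, star_trivial, smul_neg, ← neg_smul]

/-- `θ ↦ exp(θW)` is smooth (the exponential is analytic). [folklore] -/
theorem contDiff_exp_smul (W : E →L[ℝ] E) {n : WithTop ℕ∞} :
    ContDiff ℝ n (fun θ : ℝ => NormedSpace.exp (θ • W)) := by
  have han : AnalyticOnNhd ℝ (NormedSpace.exp : (E →L[ℝ] E) → (E →L[ℝ] E)) univ :=
    fun x _ => NormedSpace.exp_analytic x
  have hexp : ContDiff ℝ n (NormedSpace.exp : (E →L[ℝ] E) → (E →L[ℝ] E)) := han.contDiff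
  exact ContDiff.comp hexp (contDiff_id.smul contDiff_const)

/-- Along a smooth phase: `s ↦ exp(φ(s)W)` is `C^n` on any set where `φ` is. [folklore] -/
theorem contDiffOn_exp_comp_smul (W : E →L[ℝ] E) {φ : ℝ → ℝ} {S : Set ℝ} {n : WithTop ℕ∞}
    (hφ : ContDiffOn ℝ n φ S) : ContDiffOn ℝ n (fun s => NormedSpace.exp (φ s • W)) S := by
  have h := (contDiff_exp_smul W (n := n)).comp_contDiffOn hφ
  exact h

/-- **Derivative of the rotation path along a phase.** If `φ` has derivative `φ'` at `s` then
`s ↦ exp(φ(s)W)` has derivative `φ' • exp(φ(s)W)∘W` at `s`. [folklore] -/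
theorem hasDerivAt_exp_comp_smul (W : E →L[ℝ] E) {φ : ℝ → ℝ} {φ' s : ℝ} (hφ : HasDerivAt φ φ' s) :
    HasDerivAt (fun σ => NormedSpace.exp (φ σ • W)) (φ' • (NormedSpace.exp (φ s • W)).comp W) s := by
  have h := HasDerivAt.scomp s (hasDerivAt_exp_smul_const W (φ s)) hφ
  exact h

/-- **The two paths of the rotating orbit.** With `φ' = −λ²` at `s`: `R = exp(φW)` has `R' = −λ² R∘W` and
`R⁻¹ = exp(−φW)` has `(R⁻¹)' = λ² R⁻¹∘W` — the hypotheses `hRc`, `hRc'` of `hasDerivAt_rotatingOrbit`. [folklore] -/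
theorem hasDerivAt_exp_paths (W : E →L[ℝ] E) {φ lam : ℝ → ℝ} {s : ℝ} (hφ : HasDerivAt φ (-(lam s ^ 2)) s) :
    HasDerivAt (fun σ => NormedSpace.exp (φ σ • W)) (-(lam s ^ 2) • (NormedSpace.exp (φ s • W)).comp W) s ∧
      HasDerivAt (fun σ => NormedSpace.exp ((-φ σ) • W)) ((lam s ^ 2) • (NormedSpace.exp ((-φ s) • W)).comp W) s := by
  refine ⟨hasDerivAt_exp_comp_smul W hφ, ?_⟩
  have hφn : HasDerivAt (fun σ => -φ σ) (-(-(lam s ^ 2))) s := hφ.fun_neg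
  have h := hasDerivAt_exp_comp_smul W (φ := fun σ => -φ σ) hφn
  rw [neg_neg] at h
  exact h

end RotatingOrbit

end MaximiserSetRigidity

end Summit.NavierStokesRegularity.NavierStokesRegularity.Theorems

end
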